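import Summits.ABC.ABC.Theorems.TwistAmplificationMazurKaneLawRecordDEDictionary
import Summits.ABC.ABC.Theorems.TwistAmplificationMazurKaneLawRecordDEEndgame
import Summits.ABC.ABC.Theorems.TwistAmplificationMazurKaneLawRecordLPDEAdapterAt
import Summits.ABC.ABC.Theorems.TwistAmplificationMazurKaneLawRecordLPDE3
import Summits.ABC.ABC.Theorems.TwistAmplificationMazurKaneLawRecordTransfer
import Summits.ABC.ABC.Theorems.TwistAmplificationMazurKaneLawRecordsV3

/-!
# Certified record exponents, pipeline v3 (the DE tool) — record `DE3` below the wall, `s₀ ∈ [3 / 2, 8 / 5]`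
# (crux `TwistAmplification.MazurKaneLaw`, stmt-ABC-2757)

Line `critical-kloosterman-powerful-moduli`, lead c4. Exact `J = 4` LP values of the kit with the DE family on this range: `.8500 / .8540 / .8792 / .8971 / .9067` at `1.5 / 1.52 / 1.55 / 1.58 / 1.6` (upper line `.57 s − .0022`);
the parametric certificate `lp_DE3` (`K = 3`, slack-mode intercept `−21/10000 ≥ −0.0022`, 2223 nodes / 1550 leaves in twelve files) gives

* `recordAt_DE3` : for every `s₀ ∈ [3 / 2, 8 / 5]`, `RecordAt s₀ (57 s₀/100 − 21/10000)` — certified `.8529 / .8814 / .9099` at `3/2 / 1.55 / 8/5`, against the previous `recordAt_RH(3/2) = .868`, `recordAt_RB(1.55) = .911`, `recordAt_RB(8/5) = .935`.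

In the crux's literal shape (`mazurKane_count_le_rpow_DE3`): for `3 / 2 ≤ s < 8 / 5` and `ε > 0`,
`#{abc triples (a,b,c) : c ≤ N, rad(abc) ≤ c^s} ≤ C · N^{57 s / 100 - 21 / 10000 + ε}`.
-/

noncomputable section

-- `Summit.<Summit>.<Problem>`: the duplicate `ABC.ABC` is deliberate (single-conjunct summit).
set_option linter.dupNamespace false

namespace Summit.ABC.ABC.Theorems.MazurKaneLaw

open Summit.ABC.ABC.Theorems.MazurKaneLaw.Toolkit

/-- **Parametric DE record instance `DE3`**: for every `s₀ ∈ [3 / 2, 8 / 5]`, `RecordInstanceDE 3 4 s₀ (57 s₀/100 − 21/10000)`, from the generated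
parametric LP lemma `lp_DE3` (bundle form) through the pointwise adapter and the DE dictionary. [folklore] -/
theorem recordInstanceDE_DE3 : ∀ s₀ : ℝ, 3 / 2 ≤ s₀ → s₀ ≤ 8 / 5 →
    Summit.ABC.ABC.Theorems.MazurKaneLaw.Toolkit.RecordInstanceDE 3 4 s₀ ((57 / 100 : ℝ) * s₀ - (21 / 10000 : ℝ)) :=
  fun s₀ h1 h2 => recordInstanceDE_of_lpCertDE 3 4 s₀ _ (by norm_num)
    (lpCertDE_of_lpHypsDE4_at 3 s₀ _ (lp_DE3 s₀ h1 h2))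

/-- **Parametric certified record `DE3`** (registered sub-goal `recordAt_DE3` of crux stmt-ABC-2757): for every `s₀ ∈ [3 / 2, 8 / 5]`,
every `s < s₀` and `ε > 0`, `#{abc triples, c ≤ N, rad(abc) ≤ c^s} ≤ C · N^{Vc(s₀) + ε}`, `Vc(s₀) = 57 s₀/100 − 21/10000`, for `N ≥ 2`. [folklore] -/
theorem recordAt_DE3 : ∀ s₀ : ℝ, 3 / 2 ≤ s₀ → s₀ ≤ 8 / 5 → Summit.ABC.ABC.Theorems.MazurKaneLaw.Toolkit.RecordAt s₀ ((57 / 100 : ℝ) * s₀ - (21 / 10000 : ℝ)) :=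
  fun s₀ h1 h2 => recordAt_of_shapeBound 4 s₀ ((57 / 100 : ℝ) * s₀ - (21 / 10000 : ℝ)) (by norm_num) (by norm_num) (by linarith)
    (by linarith) (shapeCount_le_of_recordInstanceDE 3 4 s₀ ((57 / 100 : ℝ) * s₀ - (21 / 10000 : ℝ)) (by norm_num) (by norm_num)
      (by linarith) (recordInstanceDE_DE3 s₀ h1 h2))

/-- **`DE3` in the crux's literal shape**: for `3 / 2 ≤ s < 8 / 5` and `ε > 0` there is `C` with
`#{abc triples (a,b,c) : c ≤ N, rad(abc) ≤ c^s} ≤ C · N^{Vc(s) + ε}` for all `N ≥ 2`. Take `s₀ = min (8 / 5) (s + ε)` in `recordAt_DE3`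
with `ε′ = ε/3`. [folklore] -/
theorem mazurKane_count_le_rpow_DE3 (s : ℝ) (hs1 : 3 / 2 ≤ s) (hs2 : s < 8 / 5) (ε : ℝ) (hε : 0 < ε) :
    ∃ C : ℝ, ∀ N : ℕ, 2 ≤ N →
      (Set.ncard {t : ℕ × ℕ × ℕ | Literature.NumberTheory.DiophantineGeometry.IsABCTriple t.1 t.2.1 t.2.2 ∧ t.2.2 ≤ N ∧ ((Literature.NumberTheory.DiophantineGeometry.rad t.1 t.2.1 t.2.2 : ℕ) : ℝ) ≤ (t.2.2 : ℝ) ^ s} : ℝ) ≤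
        C * (N : ℝ) ^ (57 * s / 100 - 21 / 10000 + ε) := by
  -- adapted from `mazurKane_count_le_rpow_DE` (TwistAmplificationMazurKaneLawRecordsV6.lean)
  have hm1 : min (8 / 5 : ℝ) (s + ε) ≤ 8 / 5 := min_le_left _ _
  have hm2 : min (8 / 5 : ℝ) (s + ε) ≤ s + ε := min_le_right _ _
  have hm3 : s < min (8 / 5 : ℝ) (s + ε) := lt_min hs2 (by linarith)
  obtain ⟨C, hC⟩ := recordAt_DE3 (min (8 / 5 : ℝ) (s + ε)) (by linarith) hm1 s hm3 (ε / 3) (by positivity)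
  exact ⟨max C 0, fun N hN => record_bound_mono hN (by linarith) (hC N hN)⟩

end Summit.ABC.ABC.Theorems.MazurKaneLaw

end
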